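import Summits.BirchSwinnertonDyer.BirchSwinnertonDyer.Theorems.Rank1ResidualX10bHeegnerIndexRecords
import HarnessLib

/-!
# X6 (good supersingular, semistable), rank `0`, `#Ш_an = p²` at `p ≥ 5`: same-level VISIBILITY certificate rows as DATA
# with an in-kernel recheck (cell `b2b-bsdres`, supersingular family prover A = unit `b2b-bsdres-x10b`, gen 3)

HONEST FRAMING (run/shared/lean/b2b/bsd-rank1-residual/, verbatim): the goal of the cell is to
DELETE the COMBINATION-SHAPED residual classes for ALL analytic-rank `≤ 1` elliptic curves over `ℚ`
— "full BSD formula for every rank `≤ 1` curve in class C" assembled STRICTLY from published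
theorems — so that the rank-`≤ 1` remainder becomes exactly the CONSTRUCTION-SHAPED classes, which
are TYPED (missing-input `Prop`s), NOT attempted. This is not "finishing BSD". X6 stays
CONSTRUCTION-SHAPED; nothing here is a named fact or a class theorem; nothing is booked (lane +
referee).

Computable DATA records and a decidable recheck (pattern of `Rank1ResidualX10bHeegnerIndexRecords`,
helpers reused). One record per X6 pair `(E, p)` of analytic rank `0` with `ord_p #Ш_an = 2` closed per
curve by the tree theorem `Rank1Residual.Typed.bsdp_of_wuthrich_of_congr_of_surj`
(`Typed/VisibilityCertificate.lean`: Wuthrich 2014 Prop. 21 upper bound — `ρ̄_{E,p}` surjective is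
automatic on X6, `ClassX6.surj` — + Cassels–Tate + the KERNEL visibility theorem
`exists_sha_ne_zero_of_congr_of_rank`: a congruent curve `F` of rank `≥ 2` at the same level with
`F(ℚ_v)[p] = 0` on `S = {ℓ ∣ N} ∪ {p}` makes `(ℤ/p)² ⊂ Ш(E)` visible). The two rows are the X6 pairs
`11998a1 @ 5 ← 11998b1` and `12927e1 @ 7 ← 12927d1` (HOME/b2b-bsdres-x10b/X6-ROUTE.md §1):
congruence `E[p] ≅ F[p]` by the Sturm bound at the common level `M = N` (`a_n(E) ≡ a_n(F) (mod p)`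
for all `n ≤ B = ⌊ψ(N)/6⌋ + 1`) on TWO independent engines (x11a gen 10's PARI `refined_vis.gp`,
job j086899, and this unit's pure-python `visE1_x6.py`), `rank F = 2` (Cremona; PARI `ellrank = [2,2]`;
the python engine's explicit `𝔽_p`-independence of the two generators in `F(𝔽_q)/p`), and
`#F(ℚ_v)[p] = 1` at every `v ∈ S` (python: `p ∤ c_v(F)·#F̄_ns(𝔽_v)` at `v ≠ p`, supersingularity at
`v = p`; PARI: `p`-adic roots of `ψ_p`). `VisRow.consistent` RECHECKS in the kernel: the prime
factorisation of `N` (trial division) and `p ∤ N`; `a_p(E) = a_p(F) = 0` by point counting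
(supersingular, `a_p = 0`: Kobayashi's setting); `ord_p #Ш_an(E) = 2`, `p ∤ #E(ℚ)_tors`; the Sturm
arithmetic `ψ(N)` from the factorisation and `B = ⌊ψ(N)/6⌋ + 1`; the congruence SAMPLE
`a_ℓ(E) ≡ a_ℓ(F) (mod p)` at the primes `ℓ ≤ 23` by point counting (multiplicative `ℓ ∣ N` included:
the counts give `a_ℓ ∈ {±1}`); Cremona's two generators of `F` on the curve EXACTLY (weighted
integral coordinates); and the local orders: at every `ℓ ∣ N`, `p ∤ ∏c(F) · (ℓ − a_ℓ(F))`
(`#F̄_ns(𝔽_ℓ) = ℓ − a_ℓ` at a multiplicative prime, `a_ℓ = ±1` by the point count for `ℓ ≤ 50` and by Euler's criterion on `−c₆` beyond), so `F(ℚ_ℓ)[p] = 0`. NOT rechecked here: the full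
Sturm range (`B = 3433`, `2987`; the engines'), the independence of the generators, Wuthrich's and the
visibility theorem's hypotheses beyond these integers.

References: Cremona–Mazur 2000 §3 [CremonaMazur2000]; Agashe–Stein 2002 Thm. 3.1 [AgasheStein2002];
Wuthrich 2014 Prop. 21 [Wuthrich2014]; Sturm 1987 [Sturm1987]; X6-ROUTE.md (HOME/b2b-bsdres-x10b/).
-/

set_option linter.dupNamespace false
set_option autoImplicit false

namespace Summit.BirchSwinnertonDyer.Rank1Residual.Supersingular.VisibilityRecords

open Summit.BirchSwinnertonDyer.BirchSwinnertonDyer.Rank1Residual.HeegnerIndexRecords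

/-- `a_ℓ = ℓ + 1 − #Ē(𝔽_ℓ)` by counting the affine points of the long Weierstrass equation modulo a
prime `ℓ` (all points of the reduction, singular included: valid at good AND multiplicative `ℓ` for a
minimal model, where it returns `±1`). [folklore] -/
def apCount (a : List ℤ) (ℓ : ℕ) : ℤ :=
  match a with
  | [a1, a2, a3, a4, a6] =>
      let onCurve : ℕ → ℕ → Bool := fun x y =>
        (((y : ℤ) * (y : ℤ) + a1 * (x : ℤ) * (y : ℤ) + a3 * (y : ℤ) -
          ((x : ℤ) ^ 3 + a2 * (x : ℤ) ^ 2 + a4 * (x : ℤ) + a6)) % (ℓ : ℤ)) == 0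
      let pts := ((List.range ℓ).flatMap fun x => (List.range ℓ).filter fun y => onCurve x y).length
      (ℓ : ℤ) + 1 - (1 + (pts : ℤ))
  | _ => 0

/-- `ψ(N) = [SL₂(ℤ) : Γ₀(N)] = ∏ ℓ^{e−1}(ℓ+1)` from a factorisation list. [folklore] -/
def psiOfFactors (fs : List (ℕ × ℕ)) : ℕ :=
  fs.foldl (fun acc qe => acc * qe.1 ^ (qe.2 - 1) * (qe.1 + 1)) 1

/-- Fuel-bounded binary modular exponentiation `b^e mod m`. [folklore] -/
def powModAux : ℕ → ℕ → ℕ → ℕ → ℕ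
  | 0, _, _, m => 1 % m
  | fuel + 1, b, e, m =>
      if e = 0 then 1 % m
      else
        let h := powModAux fuel b (e / 2) m
        if e % 2 = 0 then h * h % m else h * h % m * (b % m) % m

/-- `b^e mod m` (fuel 64 ≥ log₂ e for every `e < 2^64`). [folklore] -/
def powMod (b e m : ℕ) : ℕ := powModAux 64 b e m

/-- `c₆ = −b₂³ + 36 b₂ b₄ − 216 b₆`. [folklore] -/
def c6 (a : List ℤ) : ℤ :=
  match bInv a with
  | (b2, b4, b6, _) => -b2 ^ 3 + 36 * b2 * b4 - 216 * b6

/-- `a_ℓ ∈ {±1}` at an odd MULTIPLICATIVE prime `ℓ` of a minimal model: split (`+1`) iff `−c₆` is a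
non-zero square mod `ℓ` (Euler's criterion), else non-split (`−1`); for `ℓ ≤ 50` the point count is
used instead. Meaningful only at primes `ℓ ∥ N`. [folklore] -/
def aMult (a : List ℤ) (ℓ : ℕ) : ℤ :=
  if ℓ ≤ 50 then apCount a ℓ
  else
    let t := ((-c6 a) % (ℓ : ℤ)).toNat
    if powMod t ((ℓ - 1) / 2) ℓ == 1 then 1 else -1

/-- One same-level visibility certificate row (module docstring). [folklore] -/
structure VisRow where
  label : String
  ainvs : List ℤ
  N : ℕ
  Nfactors : List (ℕ × ℕ)
  p : ℕ
  tors : ℕ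
  tam : ℕ
  shaAn : ℕ
  labelF : String
  ainvsF : List ℤ
  rankF : ℕ
  tamF : ℕ
  /-- Cremona's generators of `F(ℚ)` in weighted integral coordinates `(X, Y, d)`: the point `(X/d², Y/d³)`. -/
  gensF : List (ℤ × ℤ × ℕ)
  psiN : ℕ
  sturmB : ℕ
  sturmEngines : ℕ
  deriving DecidableEq, Repr

/-- The in-kernel recheck of a row (module docstring). [folklore] -/
def VisRow.consistent (r : VisRow) : Bool :=
  (r.ainvs.length == 5) && (r.ainvsF.length == 5) && factorsOK r.N r.Nfactors &&
  decide (5 ≤ r.p) && isPrimeTD r.p && (r.N % r.p != 0) &&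
  (r.Nfactors.all fun qe => qe.2 == 1) &&                                    -- N square-free: E semistable
  (apCount r.ainvs r.p == 0) && (apCount r.ainvsF r.p == 0) &&               -- supersingular, a_p = 0, both
  (vp r.p (r.shaAn : ℤ) == 2) && (r.tors % r.p != 0) && decide (2 ≤ r.rankF) &&
  (r.psiN == psiOfFactors r.Nfactors) && (r.sturmB == r.psiN / 6 + 1) && decide (2 ≤ r.sturmEngines) &&
  -- congruence sample at the primes ℓ ≤ 23 (ℓ ≠ p), by point counting
  ([2, 3, 5, 7, 11, 13, 17, 19, 23].all fun ℓ =>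
    (ℓ == r.p) || (((apCount r.ainvs ℓ - apCount r.ainvsF ℓ) % (r.p : ℤ)) == 0)) &&
  -- the partner's generators lie on F exactly
  (r.gensF.length == 2) &&
  (r.gensF.all fun g => decide (1 ≤ g.2.2) && (weierstrassEvalZ r.ainvsF g.1 g.2.1 g.2.2 == 0)) &&
  -- local p-torsion of F trivial at every ℓ ∣ N: p ∤ ∏c(F) · #F̄_ns(𝔽_ℓ) = ∏c(F) · (ℓ − a_ℓ(F))
  (r.tamF % r.p != 0) &&
  (r.Nfactors.all fun qe => (((qe.1 : ℤ) - aMult r.ainvsF qe.1) % (r.p : ℤ)) != 0)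

/-- A list of rows is `Checked` when every row is consistent. [folklore] -/
def Checked (rs : List VisRow) : Prop := rs.all VisRow.consistent = true

/-- `Checked rs` is decidable. [folklore] -/
instance Checked.instDecidable (rs : List VisRow) : Decidable (Checked rs) :=
  inferInstanceAs (Decidable (rs.all VisRow.consistent = true))

/-- Unpacking `Checked`. [folklore] -/
theorem Checked.consistent_of_mem {rs : List VisRow} (h : Checked rs) {r : VisRow}
    (hr : r ∈ rs) : r.consistent = true :=
  List.all_eq_true.1 h r hr

/-- **X6 same-level visibility certificate rows (supersingular family prover A, x10b gen 3,
HOME/b2b-bsdres-x10b/X6-ROUTE.md §1): two rows, both CONSISTENT** — `11998a1 @ 5` (`N = 2·7·857`,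
`#Ш_an = 25`, `∏c = 8`, `#E(ℚ)_tors = 2`) with the rank-`2` partner `11998b1` (`∏c = 1`; Sturm
`B = 3433` on two engines), and `12927e1 @ 7` (`N = 3·31·139`, `#Ш_an = 49`, `∏c = 2`) with the
rank-`2` partner `12927d1` (`∏c = 2`; `B = 2987`). With the tree theorem
`Typed.bsdp_of_wuthrich_of_congr_of_surj` each row gives `BSD(E,p)` and `#Ш(E)[p^∞] = p²` per curve.
`decide` evaluates, per row: trial-division factorisation and square-freeness of `N`, `a_p = 0` for
both curves by point counting, `ord_p #Ш_an = 2`, the Sturm arithmetic, the congruences at `ℓ ≤ 23`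
by point counting, the partner's generators on the curve, and `p ∤ ∏c(F)·(ℓ − a_ℓ(F))` at every
`ℓ ∣ N`. Not a class theorem; nothing about elliptic curves is asserted; nothing is booked. -/
theorem checked_x6_rankZero_visibility : Checked [
  { label := "11998a1", ainvs := [1, 1, 0, -44782110, -114992757004], N := 11998,
    Nfactors := [(2, 1), (7, 1), (857, 1)], p := 5, tors := 2, tam := 8, shaAn := 25,
    labelF := "11998b1", ainvsF := [1, -1, 0, -7, 7], rankF := 2, tamF := 1,
    gensF := [(1, 0, 1), (3, 1, 1)], psiN := 20592, sturmB := 3433, sturmEngines := 2 },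
  { label := "12927e1", ainvs := [1, 0, 0, -42189461, -105479619702], N := 12927,
    Nfactors := [(3, 1), (31, 1), (139, 1)], p := 7, tors := 1, tam := 2, shaAn := 49,
    labelF := "12927d1", ainvsF := [1, 0, 0, -137, 606], rankF := 2, tamF := 2,
    gensF := [(7, -5, 1), (19, 47, 2)], psiN := 17920, sturmB := 2987, sturmEngines := 2 }
  ] := by
  decide

end Summit.BirchSwinnertonDyer.Rank1Residual.Supersingular.VisibilityRecords
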